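import Summits.CriticalPhenomena.SAWScalingLimit.Theses.SAWWeldingIdentification
import Summits.CriticalPhenomena.SAWScalingLimit.Theorems.SAWWeldingIdentificationWeldingSetupContinuityPrelim
import Literature.Probability.RandomPlanarGeometry.SimpleCurves

/-!
# `SAWWeldingIdentification.WeldingSetup` (stmt-CriticalPhenomena-4504): the welding is well defined

Route `SAWWeldingIdentification` of `CriticalPhenomena/SAWScalingLimit`, support item
`WeldingSetup`: (i) for every conformal rectangle `Q = (Ω; a, c_L, b, c_R)` there is a sign
`s = ±1` such that every simple chord `γ` of `(Ω; a, b)` has banks `L, R` (Newman's cross-cut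
theorem) and normalised uniformisers `φ : (ℍ; 0, ∞, s) → (L; a, b, c_L)`,
`ψ : (ℍ; 0, ∞, -s) → (R; a, b, c_R)` (Riemann mapping + Carathéodory + three-point normalisation;
the sign is the orientation of `∂Ω`, forced because conformal maps preserve orientation);
(ii) there is a welding functional `W`, Borel in `γ` for each `(Q, x)`, with `W Q γ x > 0` and
`ψ(s x) = φ(-s · W Q γ x)` for every chord, every configuration and every `x > 0`.

## Proof

`W := conformalWelding` (`Literature/…/ConformalWelding.lean`, the welding of a CHOSEN
configuration, junk `0` off simple chords). Part (i) is `exists_weldingData` (file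
`…WeldingSetupConfigA`), with the sign read off a reference chordal uniformiser `Φ` of
`Q.chord 0 2` (`Φ(t_L) = c_L`, `s = sign t_L`); the orientation rule behind it
(`…WeldingSetupSign`, `…WeldingSetupSignCore`) rests on the boundary monotonicity of holomorphic
self-maps of `ℍ` (`…WeldingSetupMonotone`, Schwarz reflection). Clause (ii) minus measurability is
`weldingSetup_partII` (`…WeldingSetupConfigB`: configuration independence by uniqueness of
chordal uniformisers up to dilation, and existence of solutions through the open chord).
CONTINUITY (`tendsto_conformalWelding`, `continuousOn_conformalWelding`, this file): if simple
chords `γ_n → γ` then representatives converge uniformly, so the boundary loops of the banks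
converge uniformly; by RADÓ'S THEOREM in the tree's packaged form
`MarkedDomain.exists_uniformizers_of_tendstoUniformly_boundary` (Pommerenke 1992, Thm. 2.11 with
Cor. 2.4) the boundary correspondences of the banks converge on the closed half-plane with
control at infinity, real preimages of converging boundary points converge
(`tendsto_real_of_boundaryExtension`, file `…WeldingSetupContinuityPrelim`), and the welding —
read through these un-normalised uniformisers by `conformalWelding_spec_chordal` — converges.
MEASURABILITY (`measurable_conformalWelding`): the set of simple chords of `(Ω; a, b)` is Borel
(`measurableSet_isSimpleChord`: simplicity is Borel by the tree's `CurveClass.measurableSet_simple'`,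
the endpoint and trace conditions are closed or countable intersections of open events), the
functional vanishes off it and is continuous on it; a function continuous on a Borel set and
constant off it is Borel (`measurable_of_restrict_of_restrict_compl`).

References: Ch. Pommerenke, *Boundary Behaviour of Conformal Maps* (1992), Thms. 2.6, 2.11,
Cor. 2.4, 2.7; M. H. A. Newman, *Elements of the topology of plane sets of points* (1939), V §11;
L. V. Ahlfors, *Complex Analysis* (1979), Ch. 6 §1.1; S. Sheffield, Ann. Probab. 44 (2016), §1.4.
-/

noncomputable section

namespace Summit.CriticalPhenomena.SAWScalingLimit.Theorems

open Set Filter Topology Complex Metric Function MeasureTheory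
open UpperHalfPlane (upperHalfPlaneSet)
open Literature.Probability.RandomPlanarGeometry Literature.Topology.PlaneTopology

/-! ### Sequential continuity of the welding -/

/-- **The conformal welding is sequentially continuous along simple chords**: if simple chords
`γ_n → γ` in `CurveClass ℂ` then `W Q γ_n x → W Q γ x` for every `x > 0` (Radó's theorem for
both banks through `exists_uniformizers_of_tendstoUniformly_boundary`, preimage convergence,
and the reading of `W` through arbitrary chordal uniformisers `conformalWelding_spec_chordal`).
Pommerenke (1992), Thm. 2.11, Cor. 2.4. [folklore] -/
theorem tendsto_conformalWelding {Q : ConformalRectangle} {x : ℝ} (hx : 0 < x)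
    {γs : ℕ → CurveClass ℂ} {γ : CurveClass ℂ}
    (hγs : ∀ n, (Q.chord 0 2 (by decide)).IsSimpleChord (γs n))
    (hγ : (Q.chord 0 2 (by decide)).IsSimpleChord γ) (hlim : Tendsto γs atTop (𝓝 γ)) :
    Tendsto (fun n => conformalWelding Q (γs n) x) atTop (𝓝 (conformalWelding Q γ x)) := by
  classical
  -- Step 1: uniformly converging parametrisations
  obtain ⟨g, gs, hg, hgs, hmk, hmks, hunif⟩ :=
    exists_reps_tendstoUniformly (fun n => (hγs n).1) hγ.1 hlim
  obtain ⟨hp, hpinj, hprange, hp0, hp1⟩ := param_of_rep hγ hg hmk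
  have hps := fun n => param_of_rep (hγs n) (hgs n) (hmks n)
  set p : ℝ → ℂ := fun t => g (projIcc 0 1 zero_le_one t) with hpdef
  set ps : ℕ → ℝ → ℂ := fun n t => gs n (projIcc 0 1 zero_le_one t) with hpsdef
  have hpunif : TendstoUniformly ps p atTop := tendstoUniformly_param hunif
  -- Step 2: bank pairs and bank domains
  obtain ⟨L, R, hb⟩ := exists_bankPair hγ
  choose Ls Rs hbs using fun n => exists_bankPair (hγs n)
  obtain ⟨DL, hDL, hLa, hLb, hDLloop⟩ := exists_leftBank_dobrushinDomain hγ hb hp hpinj hprange hp0 hp1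
  obtain ⟨DR, hDR, hRa, hRb, hDRloop⟩ := exists_rightBank_dobrushinDomain hγ hb hp hpinj hprange hp0 hp1
  choose DLs hDLs using fun n => exists_leftBank_dobrushinDomain (hγs n) (hbs n) (hps n).1
    (hps n).2.1 (hps n).2.2.1 (hps n).2.2.2.1 (hps n).2.2.2.2
  choose DRs hDRs using fun n => exists_rightBank_dobrushinDomain (hγs n) (hbs n) (hps n).1
    (hps n).2.1 (hps n).2.2.1 (hps n).2.2.2.1 (hps n).2.2.2.2
  subst hDL hDR
  have hbs' : ∀ n, (DLs n).carrier ∪ (DRs n).carrier = Q.carrier \ (γs n).range ∧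
      Disjoint (DLs n).carrier (DRs n).carrier ∧ IsOpen (DLs n).carrier ∧ IsOpen (DRs n).carrier ∧
      IsConnected (DLs n).carrier ∧ IsConnected (DRs n).carrier ∧
      Q.pt 1 ∈ closure (DLs n).carrier ∧ Q.pt 3 ∈ closure (DRs n).carrier := fun n => by
    rw [(hDLs n).1, (hDRs n).1]; exact hbs n
  -- Step 3: the boundary loops converge uniformly, the marked points are constant
  have hJL : TendstoUniformly (fun n => (DLs n).boundary) DL.boundary atTop := by
    have e : (fun n => (DLs n).boundary) = fun n =>
        concatPath (fun t => Q.boundary (Q.mark 0 + t * (Q.mark 2 - Q.mark 0))) (fun t => ps n (1 - t)) ∘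
          Int.fract :=
      funext fun n => (hDLs n).2.2.2
    rw [e, hDLloop]
    exact tendstoUniformly_loop_left hpunif
  have hJR : TendstoUniformly (fun n => (DRs n).boundary) DR.boundary atTop := by
    have e : (fun n => (DRs n).boundary) = fun n =>
        concatPath (ps n) (fun t => Q.boundary (Q.mark 2 + t * (Q.mark 0 + 1 - Q.mark 2))) ∘ Int.fract :=
      funext fun n => (hDRs n).2.2.2
    rw [e, hDRloop]
    exact tendstoUniformly_loop_right hpunif
  have hLa' : Tendsto (fun n => (DLs n).pt 0) atTop (𝓝 (DL.pt 0)) := by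
    rw [hLa]; exact tendsto_const_nhds.congr fun n => ((hDLs n).2.1).symm
  have hLb' : Tendsto (fun n => (DLs n).pt 1) atTop (𝓝 (DL.pt 1)) := by
    rw [hLb]; exact tendsto_const_nhds.congr fun n => ((hDLs n).2.2.1).symm
  have hRa' : Tendsto (fun n => (DRs n).pt 0) atTop (𝓝 (DR.pt 0)) := by
    rw [hRa]; exact tendsto_const_nhds.congr fun n => ((hDRs n).2.1).symm
  have hRb' : Tendsto (fun n => (DRs n).pt 1) atTop (𝓝 (DR.pt 1)) := by
    rw [hRb]; exact tendsto_const_nhds.congr fun n => ((hDRs n).2.2.1).symm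
  -- Step 4: Radó (packaged): chordal uniformisers with converging boundary correspondences
  obtain ⟨zL, hzL⟩ := DL.nonempty
  obtain ⟨zR, hzR⟩ := DR.nonempty
  have hzLn : ∀ᶠ n in atTop, zL ∈ (DLs n).carrier :=
    JordanDomain.eventually_mem_carrier_of_tendstoUniformly (D := fun n => (DLs n).toJordanDomain) hJL hzL
  have hzRn : ∀ᶠ n in atTop, zR ∈ (DRs n).carrier :=
    JordanDomain.eventually_mem_carrier_of_tendstoUniformly (D := fun n => (DRs n).toJordanDomain) hJR hzR
  obtain ⟨φ, φs, hφ, hφs, hU1, -, hU2⟩ :=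
    MarkedDomain.exists_uniformizers_of_tendstoUniformly_boundary hJL hLa' hLb' hzL hzLn
  obtain ⟨ψ, ψs, hψ, hψs, hV1, -, hV2⟩ :=
    MarkedDomain.exists_uniformizers_of_tendstoUniformly_boundary hJR hRa' hRb' hzR hzRn
  -- Step 5: real points over `c_L`, `c_R`
  have hcL : ∀ D : DobrushinDomain, (∃ R', D.carrier ∪ R' = Q.carrier \ γ.range ∧ Disjoint D.carrier R' ∧
      IsOpen D.carrier ∧ IsOpen R' ∧ IsConnected D.carrier ∧ IsConnected R' ∧
      Q.pt 1 ∈ closure D.carrier ∧ Q.pt 3 ∈ closure R') → Q.pt 1 ∈ frontier D.carrier := by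
    rintro D ⟨R', h⟩
    rw [(frontier_banks_eq hγ h).1, image_Icc_left_eq]
    exact Or.inr (Or.inl (pt_one_mem_arc Q))
  have htex : ∃ t : ℝ, t ≠ 0 ∧ φ.boundaryExtension t = Q.pt 1 :=
    exists_ne_zero_boundaryExtension_eq φ hφ (hcL DL ⟨DR.carrier, hb⟩)
      (by rw [hLa]; exact fun h => absurd (Q.pt_injective h) (by decide))
      (by rw [hLb]; exact fun h => absurd (Q.pt_injective h) (by decide))
  obtain ⟨t, ht0, ht⟩ := htex
  have htsex : ∀ n, ∃ t : ℝ, t ≠ 0 ∧ (φs n).boundaryExtension t = Q.pt 1 := fun n =>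
    exists_ne_zero_boundaryExtension_eq (φs n) (hφs n)
      (by rw [(frontier_banks_eq (hγs n) (hbs' n)).1, image_Icc_left_eq]; exact Or.inr (Or.inl (pt_one_mem_arc Q)))
      (by rw [(hDLs n).2.1]; exact fun h => absurd (Q.pt_injective h) (by decide))
      (by rw [(hDLs n).2.2.1]; exact fun h => absurd (Q.pt_injective h) (by decide))
  choose ts hts0 hts using htsex
  have huex : ∃ u : ℝ, u ≠ 0 ∧ ψ.boundaryExtension u = Q.pt 3 :=
    exists_ne_zero_boundaryExtension_eq ψ hψ
      (by rw [(frontier_banks_eq hγ hb).2, image_Icc_right_eq]; exact Or.inr (Or.inl (pt_three_mem_arc Q)))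
      (by rw [hRa]; exact fun h => absurd (Q.pt_injective h) (by decide))
      (by rw [hRb]; exact fun h => absurd (Q.pt_injective h) (by decide))
  obtain ⟨u, hu0, hu⟩ := huex
  have husex : ∀ n, ∃ u : ℝ, u ≠ 0 ∧ (ψs n).boundaryExtension u = Q.pt 3 := fun n =>
    exists_ne_zero_boundaryExtension_eq (ψs n) (hψs n)
      (by rw [(frontier_banks_eq (hγs n) (hbs' n)).2, image_Icc_right_eq]; exact Or.inr (Or.inl (pt_three_mem_arc Q)))
      (by rw [(hDRs n).2.1]; exact fun h => absurd (Q.pt_injective h) (by decide))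
      (by rw [(hDRs n).2.2.1]; exact fun h => absurd (Q.pt_injective h) (by decide))
  choose us hus0 hus using husex
  -- boundary-value forms of the chordal conditions, with the marked points of `Q`
  have hφ0 : φ.HasBoundaryValue 0 (Q.pt 0) := hLa ▸ hφ.1
  have hφi : φ.HasBoundaryValueAtInfty (Q.pt 2) := hLb ▸ hφ.2
  have hψ0 : ψ.HasBoundaryValue 0 (Q.pt 0) := hRa ▸ hψ.1
  have hψi : ψ.HasBoundaryValueAtInfty (Q.pt 2) := hRb ▸ hψ.2
  have hφs0 : ∀ n, (φs n).HasBoundaryValue 0 (Q.pt 0) := fun n => (hDLs n).2.1 ▸ (hφs n).1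
  have hφsi : ∀ n, (φs n).HasBoundaryValueAtInfty (Q.pt 2) := fun n => (hDLs n).2.2.1 ▸ (hφs n).2
  have hψs0 : ∀ n, (ψs n).HasBoundaryValue 0 (Q.pt 0) := fun n => (hDRs n).2.1 ▸ (hψs n).1
  have hψsi : ∀ n, (ψs n).HasBoundaryValueAtInfty (Q.pt 2) := fun n => (hDRs n).2.2.1 ▸ (hψs n).2
  -- Step 6: `t_n → t`, `u_n → u`
  have htlim : Tendsto ts atTop (𝓝 t) :=
    tendsto_real_of_boundaryExtension φ hφ φs hU1 hU2 hLb' (qs := fun _ => Q.pt 1)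
      hts tendsto_const_nhds ht
  have hulim : Tendsto us atTop (𝓝 u) :=
    tendsto_real_of_boundaryExtension ψ hψ ψs hV1 hV2 hRb' (qs := fun _ => Q.pt 3)
      hus tendsto_const_nhds hu
  -- Step 7: the welding equations through these uniformisers
  have hW := fun n => conformalWelding_spec_chordal (hγs n) (hbs' n) (φs n) (ψs n) (hφs0 n) (hφsi n)
    (hψs0 n) (hψsi n) (hts n) (hus n) hx
  obtain ⟨hWpos, hWeq⟩ := conformalWelding_spec_chordal hγ hb φ ψ hφ0 hφi hψ0 hψi ht hu hx
  -- Step 8: the right-hand points converge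
  set qs : ℕ → ℂ := fun n => (ψs n).boundaryExtension ((-(us n * x) : ℝ) : ℂ) with hqsdef
  set q : ℂ := ψ.boundaryExtension ((-(u * x) : ℝ) : ℂ) with hqdef
  have hqlim : Tendsto qs atTop (𝓝 q) := by
    have hcont : ContinuousWithinAt ψ.boundaryExtension {z : ℂ | 0 ≤ z.im} ((-(u * x) : ℝ) : ℂ) := by
      have h := JordanDomain.continuousOn_boundaryExtension_holds DR.toJordanDomain ψ
      rw [ConformalEquiv.closure_upperHalfPlaneSet_eq] at h
      exact h _ (by simp)
    have harg : Tendsto (fun n => ((-(us n * x) : ℝ) : ℂ)) atTop (𝓝[{z : ℂ | 0 ≤ z.im}] ((-(u * x) : ℝ) : ℂ)) := by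
      refine tendsto_nhdsWithin_iff.2 ⟨?_, Eventually.of_forall fun n => by simp⟩
      exact (continuous_ofReal.tendsto _).comp ((hulim.mul_const x).neg)
    exact hV1.tendsto_comp hcont harg
  -- Step 9: the left-hand real points converge, hence the weldings
  have hτlim : Tendsto (fun n => -(ts n * conformalWelding Q (γs n) x)) atTop
      (𝓝 (-(t * conformalWelding Q γ x))) :=
    tendsto_real_of_boundaryExtension φ hφ φs hU1 hU2 hLb' (fun n => (hW n).2.symm) hqlim hWeq.symm
  have h1 : Tendsto (fun n => (ts n * conformalWelding Q (γs n) x) / ts n) atTop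
      (𝓝 ((t * conformalWelding Q γ x) / t)) := by
    have := hτlim.neg
    simp only [neg_neg] at this
    exact this.div htlim ht0
  have h2 : (fun n => (ts n * conformalWelding Q (γs n) x) / ts n) = fun n => conformalWelding Q (γs n) x := by
    funext n
    rw [mul_div_cancel_left₀ _ (hts0 n)]
  rw [h2, mul_div_cancel_left₀ _ ht0] at h1
  exact h1

/-- **Continuity of the conformal welding on the set of simple chords.** For every conformal
rectangle `Q` and every `x`, `γ ↦ conformalWelding Q γ x` is continuous on
`{γ | γ is a simple chord of (Ω; a, b)}` (for `x ≤ 0` it is the zero function). [folklore] -/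
theorem continuousOn_conformalWelding (Q : ConformalRectangle) (x : ℝ) :
    ContinuousOn (fun γ : CurveClass ℂ => conformalWelding Q γ x)
      {γ | (Q.chord 0 2 (by decide)).IsSimpleChord γ} := by
  classical
  rcases le_or_gt x 0 with hx | hx
  · have : (fun γ : CurveClass ℂ => conformalWelding Q γ x) = fun _ => 0 := by
      funext γ; exact conformalWelding_of_nonpos hx
    rw [this]
    exact continuousOn_const
  intro γ hγ
  refine tendsto_of_seq_tendsto fun γs hγs => ?_
  rw [tendsto_nhdsWithin_iff] at hγs
  obtain ⟨hlim, hmem⟩ := hγs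
  -- replace the finitely many non-chords by `γ`
  set γs' : ℕ → CurveClass ℂ := fun n => if (Q.chord 0 2 (by decide)).IsSimpleChord (γs n) then γs n else γ
  have hγs' : ∀ n, (Q.chord 0 2 (by decide)).IsSimpleChord (γs' n) := fun n => by
    by_cases h : (Q.chord 0 2 (by decide)).IsSimpleChord (γs n)
    · simp only [γs', if_pos h]; exact h
    · simp only [γs', if_neg h]; exact hγ
  have heq : ∀ᶠ n in atTop, γs' n = γs n := by
    filter_upwards [hmem] with n hn
    exact if_pos hn
  have hlim' : Tendsto γs' atTop (𝓝 γ) := hlim.congr' (heq.mono fun n hn => hn.symm)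
  have h := tendsto_conformalWelding hx hγs' hγ hlim'
  exact h.congr' (heq.mono fun n hn => by simp only [Function.comp_apply, hn])

/-! ### The set of simple chords is Borel -/

/-- The trace condition "`γ` meets `∂Ω` only in `{a, b}`" as a countable intersection of the open
events "`γ` avoids the closed set `∂Ω ∖ (B(a, 1/(n+1)) ∪ B(b, 1/(n+1)))`". [folklore] -/
theorem setOf_range_inter_frontier_subset_eq (Q : ConformalRectangle) :
    {γ : CurveClass ℂ | γ.range ∩ frontier Q.carrier ⊆ {Q.pt 0, Q.pt 2}} =
      ⋂ n : ℕ, CurveClass.rangeSubset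
        (frontier Q.carrier \ (ball (Q.pt 0) (1 / ((n : ℝ) + 1)) ∪ ball (Q.pt 2) (1 / ((n : ℝ) + 1))))ᶜ := by
  ext γ
  simp only [mem_setOf_eq, mem_iInter, CurveClass.mem_rangeSubset]
  constructor
  · intro h n z hz hzK
    rcases h ⟨hz, hzK.1⟩ with rfl | rfl
    · exact hzK.2 (Or.inl (mem_ball_self (by positivity)))
    · exact hzK.2 (Or.inr (mem_ball_self (by positivity)))
  · intro h z hz
    by_contra hne
    simp only [mem_insert_iff, mem_singleton_iff, not_or] at hne
    have hd : 0 < min (dist z (Q.pt 0)) (dist z (Q.pt 2)) :=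
      lt_min (dist_pos.2 hne.1) (dist_pos.2 hne.2)
    obtain ⟨n, hn⟩ := exists_nat_one_div_lt hd
    refine h n hz.1 ⟨hz.2, ?_⟩
    rintro (hb | hb)
    · rw [mem_ball] at hb
      exact absurd (hb.trans hn) (not_lt.2 (min_le_left _ _))
    · rw [mem_ball] at hb
      exact absurd (hb.trans hn) (not_lt.2 (min_le_right _ _))

/-- **The set of simple chords of `(Ω; a, b)` is Borel** in `CurveClass ℂ`: simplicity is Borel
(`CurveClass.measurableSet_simple'`, Aizenman–Burchard), the endpoint conditions are closed, the
trace conditions are a closed event and a countable intersection of open events. [folklore] -/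
theorem measurableSet_isSimpleChord (Q : ConformalRectangle) :
    MeasurableSet {γ : CurveClass ℂ | (Q.chord 0 2 (by decide)).IsSimpleChord γ} := by
  have h1 : MeasurableSet (CurveClass.simple : Set (CurveClass ℂ)) := CurveClass.measurableSet_simple'
  have h2 : MeasurableSet {γ : CurveClass ℂ | γ.source = Q.pt 0} :=
    (isClosed_eq CurveClass.continuous_source continuous_const).measurableSet
  have h3 : MeasurableSet {γ : CurveClass ℂ | γ.target = Q.pt 2} :=
    (isClosed_eq CurveClass.continuous_target continuous_const).measurableSet
  have h4 : MeasurableSet (CurveClass.rangeSubset (closure Q.carrier) : Set (CurveClass ℂ)) :=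
    CurveClass.measurableSet_rangeSubset isClosed_closure
  have h5 : MeasurableSet {γ : CurveClass ℂ | γ.range ∩ frontier Q.carrier ⊆ {Q.pt 0, Q.pt 2}} := by
    rw [setOf_range_inter_frontier_subset_eq]
    refine MeasurableSet.iInter fun n => ?_
    have hK : IsClosed (frontier Q.carrier \
        (ball (Q.pt 0) (1 / ((n : ℝ) + 1)) ∪ ball (Q.pt 2) (1 / ((n : ℝ) + 1)))) :=
      isClosed_frontier.sdiff (isOpen_ball.union isOpen_ball)
    have : (CurveClass.rangeSubset (frontier Q.carrier \
        (ball (Q.pt 0) (1 / ((n : ℝ) + 1)) ∪ ball (Q.pt 2) (1 / ((n : ℝ) + 1))))ᶜ : Set (CurveClass ℂ)) =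
        (CurveClass.hitsBefore (frontier Q.carrier \
          (ball (Q.pt 0) (1 / ((n : ℝ) + 1)) ∪ ball (Q.pt 2) (1 / ((n : ℝ) + 1)))) ∅)ᶜ := by
      rw [CurveClass.hitsBefore_empty_right, compl_compl]
    rw [this]
    exact (CurveClass.isClosed_hitsBefore_empty_right hK).measurableSet.compl
  have heq : {γ : CurveClass ℂ | (Q.chord 0 2 (by decide)).IsSimpleChord γ} =
      CurveClass.simple ∩ {γ | γ.source = Q.pt 0} ∩ {γ | γ.target = Q.pt 2} ∩
        CurveClass.rangeSubset (closure Q.carrier) ∩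
        {γ : CurveClass ℂ | γ.range ∩ frontier Q.carrier ⊆ {Q.pt 0, Q.pt 2}} := by
    ext γ
    simp only [mem_setOf_eq, mem_inter_iff, CurveClass.mem_rangeSubset, MarkedDomain.IsSimpleChord]
    constructor
    · rintro ⟨a, b, c, d, e⟩
      exact ⟨⟨⟨⟨a, b⟩, c⟩, d⟩, e⟩
    · rintro ⟨⟨⟨⟨a, b⟩, c⟩, d⟩, e⟩
      exact ⟨a, b, c, d, e⟩
  rw [heq]
  exact (((h1.inter h2).inter h3).inter h4).inter h5

/-! ### Borel measurability of the welding functional -/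

/-- **The conformal welding is Borel in the chord**: for every conformal rectangle `Q` and real
`x`, `γ ↦ conformalWelding Q γ x` is measurable on `CurveClass ℂ` — continuous on the Borel set
of simple chords (`continuousOn_conformalWelding`) and zero off it. [folklore] -/
theorem measurable_conformalWelding (Q : ConformalRectangle) (x : ℝ) :
    Measurable fun γ : CurveClass ℂ => conformalWelding Q γ x := by
  set S : Set (CurveClass ℂ) := {γ | (Q.chord 0 2 (by decide)).IsSimpleChord γ} with hS
  refine measurable_of_restrict_of_restrict_compl (measurableSet_isSimpleChord Q) ?_ ?_
  · exact (continuousOn_iff_continuous_restrict.1 (continuousOn_conformalWelding Q x)).measurable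
  · have : (Sᶜ.restrict fun γ : CurveClass ℂ => conformalWelding Q γ x) = fun _ => 0 := by
      funext γ
      have hγ : ¬ (Q.chord 0 2 (by decide)).IsSimpleChord (γ : CurveClass ℂ) := γ.2
      simp only [restrict_apply, conformalWelding_of_not_isSimpleChord hγ, Pi.zero_apply]
    rw [this]
    exact measurable_const

/-! ### The item -/

/-- **`SAWWeldingIdentification.WeldingSetup` (stmt-CriticalPhenomena-4504) holds**: (i) every
conformal rectangle has a sign `s = ±1` for which every simple chord of `(Ω; a, b)` has banks and
normalised uniformisers `φ : (ℍ; 0, ∞, s) → (L; a, b, c_L)`, `ψ : (ℍ; 0, ∞, -s) → (R; a, b, c_R)`;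
(ii) the Literature functional `W := conformalWelding` is Borel in the chord and solves the
welding equation `ψ(s x) = φ(-s · W Q γ x)`, `W Q γ x > 0`, of every configuration of every chord
at every `x > 0`. Newman (1939) V §11; Pommerenke (1992) Thms. 2.6, 2.11, Cor. 2.4, 2.7;
Ahlfors (1979) Ch. 6 §1.1. -/
theorem WeldingSetup_proof :
    Summit.CriticalPhenomena.SAWScalingLimit.Theses.SAWWeldingIdentification.WeldingSetup := by
  refine ⟨fun Q => ?_, conformalWelding, measurable_conformalWelding, weldingSetup_partII⟩
  obtain ⟨Φ, hΦ⟩ := MarkedDomain.exists_isChordalUniformizing_holds (Q.chord 0 2 (by decide))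
  obtain ⟨tL, htL0, htL⟩ := exists_boundaryExtension_eq_pt_one Φ hΦ
  by_cases ht : 0 < tL
  · exact ⟨1, Or.inl rfl, fun γ hγ => exists_weldingData hγ Φ hΦ htL (Or.inl ⟨ht, rfl⟩)⟩
  · exact ⟨-1, Or.inr rfl, fun γ hγ =>
      exists_weldingData hγ Φ hΦ htL (Or.inr ⟨lt_of_le_of_ne (not_lt.1 ht) htL0, rfl⟩)⟩

end Summit.CriticalPhenomena.SAWScalingLimit.Theorems
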